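import Literature.NumberTheory.GaloisRepresentations.GaloisCohomologyLayerInflationCup
import HarnessLib

/-!
# Layer inflation commutes with restriction to an extension field `L/K`:
# `res_{L/K} (inf_E x) = inf_{E_L} (Res x)` in degrees `1` and `2`, `E_L = L·E ⊆ L̄`
# (Serre, *Galois Cohomology* I §2.4–2.6; Neukirch–Schmidt–Wingberg (1.5.2))

Topic `NumberTheory/GaloisRepresentations`; namespace `Literature.NumberTheory.GaloisRepresentations`.
Definitions with bodies and theorems; no named fact, no instance, no notation.  Sequel to
`GaloisCohomologyLayerInflationTwo` (door-c6 g9: `infTwo`) and `GaloisCohomologyLayerInflationCup`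
(door-c6 g10: `infOneLayer`).

Let `K ⊆ L` be fields (`L : Type`, `[Algebra K L]`; e.g. a completion `K_v` of a number field), `ρ` a
discrete `Γ_K`-module on `M`, and `E ⊆ K̄` a finite normal layer.  Along the tree's chosen embedding
`K̄ → L̄` (`absClosureEmbedding K L`) and restriction `absGaloisRestrict K L : Γ_L → Γ_K`, the layer `E`
generates the layer **`baseChangeLayer K L E = L·E ⊆ L̄`** (`IntermediateField.adjoin`; for `L = K_v` and
`E` Galois over a number field this IS door-c5's `SemiLocal.compositum (E.val) v`, Galois over `K_v` with
group the decomposition group — `isGalois_compositum`, `autCompositumMulEquivStabilizer`).  Assuming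
`[FiniteDimensional L (L·E)] [Normal L (L·E)]` (instances the consumer has in the cases of interest):

* §1 `absGaloisRestrict_mem_absGaloisFixingSubgroup_baseChangeLayer` (`Γ_{L·E} → Γ_E`), the induced
  **`layerResQuotientMap : Γ_L ⧸ Γ_{L·E} →* Γ_K ⧸ Γ_E`** (injective in the Galois case — the decomposition
  group — not needed here), the inclusion `layerResInclHom : Res (M^{Γ_E}) ⟶ M^{Γ_{L·E}}` of layer
  modules (`ρ|_{Γ_L} = ρ.restrictField L`), and **`layerResCohomology n : Hⁿ(Γ_K ⧸ Γ_E, M^{Γ_E}) ⟶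
  Hⁿ(Γ_L ⧸ Γ_{L·E}, M^{Γ_{L·E}})`** (Mathlib `groupCohomology.map`).
* §2 **`res_infOneLayer`**: `galoisCohomology.res ρ L 1 (infOneLayer ρ E x) = infOneLayer (ρ.restrictField L) (L·E) (layerResCohomology 1 x)`
  and **`res_infTwo`**: `galoisCohomology.res ρ L 2 (infTwo ρ E x) = infTwo (ρ.restrictField L) (L·E) (layerResCohomology 2 x)`
  — both sides are the classes of `s ↦ f((res s)‾)`, resp. `(s, t) ↦ f((res s)‾, (res t)‾)`
  (tree `map_oneCocycleClass` / `map_twoCocycleClass`, `infOneLayer_H1π`, `infTwo_H2π`).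

This is the LOCALISATION square for layer classes: with `L = K_v` it says that the localisation
`H^r(K, M) → H^r(K_v, M)` of a class inflated from `Gal(E/K)` is the inflation of its restriction to the
decomposition group `Gal(K_v E/K_v)`, the compatibility every comparison of the GLOBAL finite-layer
objects (idèle classes, door-c4/door-c5) with the LOCAL ones (door-c6's canonical classes, local duality)
goes through in the Poitou–Tate assembly (Route A of the bsd-schneider cell).  HONEST FRAMING:
homological algebra only.

## References
* J.-P. Serre, *Galois Cohomology* (1997), Ch. I §2.4 (compatible pairs), §2.6, Ch. II §6.1
  (localisation). [SerreGaloisCohomology1997]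
* J. Neukirch, A. Schmidt, K. Wingberg, *Cohomology of Number Fields* (2008), (1.5.2) (functoriality of
  inflation and restriction). [NeukirchSchmidtWingberg2008]
-/

noncomputable section

open CategoryTheory groupCohomology Field Function

namespace Literature.NumberTheory.GaloisRepresentations

open LocalWeilDatum

variable (K : Type) [Field K] (L : Type) [Field L] [Algebra K L]
variable (E : IntermediateField K (AlgebraicClosure K)) [FiniteDimensional K E] [Normal K E]

/-! ## §1. The layer `L·E ⊆ L̄`, the groups and the modules -/

omit [FiniteDimensional K E] [Normal K E] in
/-- **The layer `L·E ⊆ L̄` generated over `L` by the image of `E` under the chosen `K̄ → L̄`** (for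
`L = K_v`: door-c5's `SemiLocal.compositum E.val v`, "`L_w = K_v L`", Cassels–Fröhlich II §10).
[cite: SerreGaloisCohomology1997, II §6.1] -/
def baseChangeLayer : IntermediateField L (AlgebraicClosure L) :=
  IntermediateField.adjoin L (Set.range ((absClosureEmbedding K L).comp E.val))

omit [FiniteDimensional K E] [Normal K E] in
/-- The image of `E` lies in `L·E`. [cite: SerreGaloisCohomology1997, II §6.1] -/
theorem absClosureEmbedding_mem_baseChangeLayer (x : E) :
    absClosureEmbedding K L (x : AlgebraicClosure K) ∈ baseChangeLayer K L E :=
  IntermediateField.subset_adjoin L _ ⟨x, rfl⟩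

variable [Normal L (baseChangeLayer K L E)]

omit [FiniteDimensional K E] in
/-- **`res (Γ_{L·E}) ⊆ Γ_E`**: an automorphism of `L̄` fixing `L·E` restricts to one of `K̄` fixing `E`
(`ι (res σ • x) = σ • ι x`, `ι` injective). [cite: SerreGaloisCohomology1997, I §2.4] -/
theorem absGaloisRestrict_mem_absGaloisFixingSubgroup_baseChangeLayer {σ : absoluteGaloisGroup L}
    (hσ : σ ∈ absGaloisFixingSubgroup (baseChangeLayer K L E)) :
    absGaloisRestrict K L σ ∈ absGaloisFixingSubgroup E := by
  rw [mem_absGaloisFixingSubgroup_iff] at hσ ⊢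
  intro x hx
  apply (absClosureEmbedding K L).injective
  change absClosureEmbedding K L _ = absClosureEmbedding K L x
  rw [absGaloisRestrict_apply_smul]
  exact hσ _ (absClosureEmbedding_mem_baseChangeLayer K L E ⟨x, hx⟩)

omit [FiniteDimensional K E] in
/-- **The induced map `Γ_L ⧸ Γ_{L·E} →* Γ_K ⧸ Γ_E`** (`[s] ↦ [res s]`; for `L = K_v` and `E/K` Galois the
embedding of the decomposition group). [cite: SerreGaloisCohomology1997, I §2.4][cite: NeukirchSchmidtWingberg2008, (1.5.2)] -/
def layerResQuotientMap :
    absoluteGaloisGroup L ⧸ absGaloisFixingSubgroup (baseChangeLayer K L E) →*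
      absoluteGaloisGroup K ⧸ absGaloisFixingSubgroup E :=
  QuotientGroup.map _ _ (absGaloisRestrict K L : absoluteGaloisGroup L →* absoluteGaloisGroup K)
    fun _ hσ => absGaloisRestrict_mem_absGaloisFixingSubgroup_baseChangeLayer K L E hσ

omit [FiniteDimensional K E] in
/-- `layerResQuotientMap [s] = [res s]`. [cite: SerreGaloisCohomology1997, I §2.4] -/
@[simp] theorem layerResQuotientMap_mk (s : absoluteGaloisGroup L) :
    layerResQuotientMap K L E (s : absoluteGaloisGroup L ⧸ absGaloisFixingSubgroup (baseChangeLayer K L E)) =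
      (absGaloisRestrict K L s : absoluteGaloisGroup K ⧸ absGaloisFixingSubgroup E) := rfl

variable {M : Type} [AddCommGroup M] [TopologicalSpace M] [DiscreteTopology M] (ρ : DiscreteGaloisModule K M)

omit [FiniteDimensional K E] in
/-- **The inclusion `M^{Γ_E} ⊆ M^{Γ_{L·E}}`** (invariants of `ρ|_{Γ_L} = ρ.restrictField L` under `Γ_{L·E}`) as a
morphism `Res (M^{Γ_E}) ⟶ M^{Γ_{L·E}}` of `Rep ℤ (Γ_L ⧸ Γ_{L·E})` along `layerResQuotientMap`.
[cite: SerreGaloisCohomology1997, I §2.4 (compatible pairs)] -/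
def layerResInclHom :
    Rep.res (layerResQuotientMap K L E) (absGaloisLayerRep K E ρ) ⟶
      absGaloisLayerRep L (baseChangeLayer K L E) (ρ.restrictField L) :=
  Rep.ofHom (LinearMap.intertwiningMap_of_isIntertwiningMap _ _
    (Submodule.inclusion (p := Representation.invariants
        (ρ.toRepresentation.comp (absGaloisFixingSubgroup E).subtype))
      (p' := Representation.invariants
        ((ρ.restrictField L).toRepresentation.comp (absGaloisFixingSubgroup (baseChangeLayer K L E)).subtype))
      (fun w hw s => hw ⟨absGaloisRestrict K L (s : absoluteGaloisGroup L),
        absGaloisRestrict_mem_absGaloisFixingSubgroup_baseChangeLayer K L E s.2⟩))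
    fun q w => by
      induction q using QuotientGroup.induction_on with
      | H s => rfl)

omit [FiniteDimensional K E] in
/-- Unfolding: `layerResInclHom w = w` in `M`. [cite: SerreGaloisCohomology1997, I §2.4] -/
@[simp] theorem layerResInclHom_hom_apply_coe
    (w : Representation.invariants (ρ.toRepresentation.comp (absGaloisFixingSubgroup E).subtype)) :
    ((layerResInclHom K L E ρ).hom w : M) = (w : M) := rfl

omit [FiniteDimensional K E] in
/-- **Restriction of layers `Res : Hⁿ(Γ_K ⧸ Γ_E, M^{Γ_E}) ⟶ Hⁿ(Γ_L ⧸ Γ_{L·E}, M^{Γ_{L·E}})`** (Mathlib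
`groupCohomology.map` along `layerResQuotientMap`, `layerResInclHom`). [cite: NeukirchSchmidtWingberg2008, (1.5.2)] -/
def layerResCohomology (n : ℕ) :
    groupCohomology (absGaloisLayerRep K E ρ) n ⟶
      groupCohomology (absGaloisLayerRep L (baseChangeLayer K L E) (ρ.restrictField L)) n :=
  groupCohomology.map (layerResQuotientMap K L E) (layerResInclHom K L E ρ) n

/-! ## §2. The squares `res ∘ inf_E = inf_{L·E} ∘ Res` in degrees one and two -/

variable [FiniteDimensional L (baseChangeLayer K L E)]

/-- **Degree one: `res_{L/K} (inf_E x) = inf_{L·E} (Res x)`** — both are the class of the crossed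
homomorphism `s ↦ f((res s)‾)` of `Γ_L`. [cite: SerreGaloisCohomology1997, I §2.4, §2.6]
[cite: NeukirchSchmidtWingberg2008, (1.5.2)] -/
theorem res_infOneLayer (x : groupCohomology (absGaloisLayerRep K E ρ) 1) :
    galoisCohomology.res ρ L 1 (infOneLayer K E ρ x) =
      infOneLayer L (baseChangeLayer K L E) (ρ.restrictField L) (layerResCohomology K L E ρ 1 x) := by
  haveI : CompactSpace (absoluteGaloisGroup K) := absoluteGaloisGroup_compactSpace K
  haveI : CompactSpace (absoluteGaloisGroup L) := absoluteGaloisGroup_compactSpace L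
  induction x using H1_induction_on with
  | h f =>
  have e1 : layerResCohomology K L E ρ 1 (H1π (absGaloisLayerRep K E ρ) f) =
      H1π (absGaloisLayerRep L (baseChangeLayer K L E) (ρ.restrictField L))
        (mapCocycles₁ (layerResQuotientMap K L E) (layerResInclHom K L E ρ) f) :=
    H1π_comp_map_apply (layerResQuotientMap K L E) (layerResInclHom K L E ρ) f
  have e2 := infOneLayer_H1π L (baseChangeLayer K L E) (ρ.restrictField L)
    (mapCocycles₁ (layerResQuotientMap K L E) (layerResInclHom K L E ρ) f)
  have e3 := infOneLayer_H1π K E ρ f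
  -- the restriction of the inflated cocycle
  have e4 : galoisCohomology.res ρ L 1 (oneCocycleClass ρ.toTopRep (inflateOneCocycle K E ρ f)) =
      oneCocycleClass (DiscreteGaloisModule.toTopRep (ρ.restrictField L))
        (contOneCocycles.pullback (absGaloisRestrict K L) (X := ρ.toTopRep)
          (Y := DiscreteGaloisModule.toTopRep (ρ.restrictField L))
          (TopRep.ofHom ⟨ContinuousLinearMap.id ℤ M, fun _ => rfl⟩) (inflateOneCocycle K E ρ f)) :=
    map_oneCocycleClass (absGaloisRestrict K L) (X := ρ.toTopRep)
      (Y := DiscreteGaloisModule.toTopRep (ρ.restrictField L))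
      (TopRep.ofHom ⟨ContinuousLinearMap.id ℤ M, fun _ => rfl⟩) _
  have hc : contOneCocycles.pullback (absGaloisRestrict K L) (X := ρ.toTopRep)
        (Y := DiscreteGaloisModule.toTopRep (ρ.restrictField L))
        (TopRep.ofHom ⟨ContinuousLinearMap.id ℤ M, fun _ => rfl⟩) (inflateOneCocycle K E ρ f) =
      inflateOneCocycle L (baseChangeLayer K L E) (ρ.restrictField L)
        (mapCocycles₁ (layerResQuotientMap K L E) (layerResInclHom K L E ρ) f) := by
    refine Subtype.ext (ContinuousMap.ext fun s => ?_)
    rw [contOneCocycles.pullback_apply, inflateOneCocycle_apply, inflateOneCocycle_apply, coe_mapCocycles₁]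
    rfl
  rw [e3, e4, hc, e1, e2]

/-- **Degree two: `res_{L/K} (inf_E x) = inf_{L·E} (Res x)`** — both are the class of the 2-cocycle
`(s, t) ↦ f((res s)‾, (res t)‾)` of `Γ_L`. [cite: SerreGaloisCohomology1997, I §2.4, §2.6]
[cite: NeukirchSchmidtWingberg2008, (1.5.2)] -/
theorem res_infTwo (x : groupCohomology (absGaloisLayerRep K E ρ) 2) :
    galoisCohomology.res ρ L 2 (infTwo K E ρ x) =
      infTwo L (baseChangeLayer K L E) (ρ.restrictField L) (layerResCohomology K L E ρ 2 x) := by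
  haveI : CompactSpace (absoluteGaloisGroup K) := absoluteGaloisGroup_compactSpace K
  haveI : CompactSpace (absoluteGaloisGroup L) := absoluteGaloisGroup_compactSpace L
  induction x using H2_induction_on with
  | h f =>
  have e1 : layerResCohomology K L E ρ 2 (H2π (absGaloisLayerRep K E ρ) f) =
      H2π (absGaloisLayerRep L (baseChangeLayer K L E) (ρ.restrictField L))
        (mapCocycles₂ (layerResQuotientMap K L E) (layerResInclHom K L E ρ) f) :=
    H2π_comp_map_apply (layerResQuotientMap K L E) (layerResInclHom K L E ρ) f
  have e2 := infTwo_H2π L (baseChangeLayer K L E) (ρ.restrictField L)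
    (mapCocycles₂ (layerResQuotientMap K L E) (layerResInclHom K L E ρ) f)
  have e3 := infTwo_H2π K E ρ f
  have e4 : galoisCohomology.res ρ L 2 (twoCocycleClass ρ.toTopRep (inflateTwoCocycle K E ρ f)) =
      twoCocycleClass (DiscreteGaloisModule.toTopRep (ρ.restrictField L))
        (contTwoCocycles.pullback (absGaloisRestrict K L) (X := ρ.toTopRep)
          (Y := DiscreteGaloisModule.toTopRep (ρ.restrictField L))
          (TopRep.ofHom ⟨ContinuousLinearMap.id ℤ M, fun _ => rfl⟩) (inflateTwoCocycle K E ρ f)) :=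
    map_twoCocycleClass (absGaloisRestrict K L) (X := ρ.toTopRep)
      (Y := DiscreteGaloisModule.toTopRep (ρ.restrictField L))
      (TopRep.ofHom ⟨ContinuousLinearMap.id ℤ M, fun _ => rfl⟩) _
  have hc : contTwoCocycles.pullback (absGaloisRestrict K L) (X := ρ.toTopRep)
        (Y := DiscreteGaloisModule.toTopRep (ρ.restrictField L))
        (TopRep.ofHom ⟨ContinuousLinearMap.id ℤ M, fun _ => rfl⟩) (inflateTwoCocycle K E ρ f) =
      inflateTwoCocycle L (baseChangeLayer K L E) (ρ.restrictField L)
        (mapCocycles₂ (layerResQuotientMap K L E) (layerResInclHom K L E ρ) f) := by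
    refine Subtype.ext (ContinuousMap.ext fun p => ?_)
    obtain ⟨s, t⟩ := p
    rw [contTwoCocycles.pullback_apply, inflateTwoCocycle_apply, inflateTwoCocycle_apply, coe_mapCocycles₂]
    rfl
  rw [e3, e4, hc, e1, e2]

end Literature.NumberTheory.GaloisRepresentations

end
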